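import Summits.BirchSwinnertonDyer.BirchSwinnertonDyer.Theorems.CongruentShaFreeCutCharacterSupply
import Summits.BirchSwinnertonDyer.BirchSwinnertonDyer.Theorems.CongruentShaFreeCutUnrSeriesWeierstrass
import Summits.BirchSwinnertonDyer.Rank1Residual.X11b.BDPValueRigidityInt
import Summits.BirchSwinnertonDyer.Rank1Residual.X11b.IntSeriesComposition
import Summits.BirchSwinnertonDyer.Rank1Residual.X11b.BDPFrameUniquenessInt
import Literature.NumberTheory.LFunctions.DworkRationalityTeichmuller
import HarnessLib

/-!
# `μ = 0` passes between BDP frames ACROSS PERIODS AND RECEPTACLES: a ♭-frame `Q ∈ 𝓞_{ℂ_p}⟦T⟧` with a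
# unit coefficient forces every `R₀`-frame `L ∈ R₀⟦T⟧` of the same `(ι, 𝔭, κ, γ, f)` — ANY non-zero periods
# — to have a unit coefficient (any prime `p`)

Seat `bsd-wall-utd-p1` g3 (lead prover, UTD crux #2 `ToricTransportModThree`, child `TwinMuZeroAtThree` =
stmt-BirchSwinnertonDyer-20400). Purpose: discharge the cross-period ♭-rigidity hypothesis `hRig` of
`UniversalToricDescentTwinMuZero.stub_twinMuZero_of_thmB_of_flatRigidity` (file
`…Theorems/UniversalToricDescentToricTransportModThreeTwinMuZero.lean`) in the weaker, sufficient currency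
of `μ`: the print `μ = 0` (Hsieh 2014 Thm. B) lives on a ♭-object `Q ∈ 𝓞_{ℂ_p}⟦T⟧` whose `R₀`-descent at
`p = 3` is not in print, while the crux quantifies over `R₀`-frames `L` with arbitrary periods; this file
proves that `μ(Q) = 0 ⟹ μ(L) = 0` WITHOUT any descent and WITHOUT Weierstrass preparation over `𝓞_{ℂ_p}`.
Companion of utd-p2's `UniversalToricDescentBDPFrameCrossPeriodRigidity.lean` (two `R₀`-frames generate the
same ideal; cn100's LEMMA R∞); the present statement is the mixed ♭ × `R₀` one that the twin's `μ` needs.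

THE ARGUMENT (cn100's power-map functional equation, then reduction modulo `𝔪_{ℂ_p}` instead of Weierstrass).
Read `L` in `𝓞_{ℂ_p}⟦T⟧` (`L♭ = map R1.unrToCpInt L`, again a ♭-frame, `R1.isBDPLFunctionInt_map`). At an
interpolation point of type `(n,-n)` the frame `L♭` takes `c^n` times the value of `Q`
(`X11b.intSeries_hasValueAt_frame_rescale`, `c = ι⁻¹((Ω_K/Ω'_K)^4)(Ω'_p/Ω_p)^4`); along cn100's character supply
(`characterSupplyAt`, every `p`: points `x_k = x₀^{p^k} − 1 → 0`, types `m p^k`, `x_{k+1} = Φ(x_k)` for the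
`p`-power map `Φ = (1+T)^p − 1`) both `L♭(Φ)·Q^p` and `L♭^p·Q(Φ)` take the value `c^{p n_k} L♭… ` — precisely
`V_{k+1} c^{n_{k+1}} V_k^p` —, so they are EQUAL in `𝓞_{ℂ_p}⟦T⟧` (identity principle
`R1.intSeries_eq_of_hasValueAt`): §1. Now write `L = p^μ L₀` with `L₀ ≢ 0 mod p` (cn100
`UnrSeries.exists_eq_C_pow_mul_map_residue_ne_zero`); if `μ ≥ 1`, cancelling `p^μ` gives
`L₀♭(Φ)·Q^p = p^{(p-1)μ} L₀♭^p·Q(Φ)`, and modulo the maximal ideal of `𝓞_{ℂ_p}` (residue field `k̄` of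
characteristic `p`, where `Φ ≡ T^p`) this reads `L̄₀♭(T^p)·Q̄^p = 0` in the DOMAIN `k̄⟦T⟧` with `Q̄ ≠ 0`
(`μ(Q) = 0`) and `L̄₀♭(T^p) ≠ 0` (`L₀` has a unit coefficient; `T ↦ T^p` is injective on coefficients,
`PowerSeries.coeff_subst_X_pow`) — a contradiction: §2. Hence `μ = 0`, i.e. `L = L₀` has a coefficient of
norm `1`, provided `L ≠ 0`, which holds because two frames vanish together (§3, the ♭ version of cn100 §1).

* §1 `flat_powerMap_identity_of_values`, `flat_powerMap_identity_of_isBDPLFunctionInt` (any `p`).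
* §2 `exists_coeff_norm_eq_one_of_flat_powerMap_identity` (pure algebra, any `p`).
* §3 `intSeries_eq_zero_of_isBDPLFunctionInt_of_eq_zero` (♭-frames vanish together).
* §4 **`exists_coeff_norm_eq_one_of_isBDPLFunctionInt_of_isBDPLFunction`** — THE `μ`-TRANSFER: `K`
  imaginary quadratic, `κ` anticyclotomic, `γ` a topological generator, periods `Ω_K, Ω'_K, Ω_p, Ω'_p ≠ 0`,
  `R1.IsBDPLFunctionInt p ι 𝔭 κ γ f Ω_K Ω_p Q`, `IsBDPLFunction ι 𝔭 κ γ f Ω'_K Ω'_p L`,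
  `∃ i, ‖[T^i]Q‖ = 1` ⟹ `∃ i, ‖[T^i]L‖ = 1`.

THEOREMS ONLY; no definition, no named fact, no `sorry`; imports no `Theses` module (route-independent).
References: [Castella2018] F. Castella, Camb. J. Math. 6 (2018), Thm. 3.1 (arXiv:1704.06608 p. 9);
[Washington1997] L. Washington, GTM 83, §7.2 (the `p`-power map); [Cassels1986] Ch. 4 (identity principle).
-/

set_option linter.dupNamespace false
set_option autoImplicit false

noncomputable section

open scoped Classical Topology NumberField

open Filter PowerSeries NumberField IsDedekindDomain Field
  Literature.NumberTheory.EllipticCurves Literature.NumberTheory.EllipticCurves.ModularForms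
  Literature.NumberTheory.GaloisRepresentations
  Summit.BirchSwinnertonDyer.Rank1Residual.X11b
  Summit.BirchSwinnertonDyer.BirchSwinnertonDyer.Theorems.CongruentShaFreeCutCharacterSupply
  Summit.BirchSwinnertonDyer.BirchSwinnertonDyer.Theorems.CongruentShaFreeCutUnrSeriesWeierstrass
  Summit.BirchSwinnertonDyer.Rank1Residual.X2.HidaLimitAlgebra

namespace Summit.BirchSwinnertonDyer.BirchSwinnertonDyer.Theorems.UniversalToricDescentFlatMuTransfer

variable {p : ℕ} [hp : Fact p.Prime]

/-! ### §1 The power-map functional equation of two ♭-frames -/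

/-- **The abstract ♭ power-map identity.** Let `Q, Q' ∈ 𝓞_{ℂ_p}⟦T⟧`, `c ∈ ℂ_p`, and let `x_k` (`‖x_k‖ < 1`,
`x_k → 0`, `x_k ≠ 0`) be STABLE under the `p`-power map, `x_{k+1} = (1 + x_k)^p − 1`, with exponents
`n_{k+1} = p·n_k`, `Q(x_k) = V_k` and `Q'(x_k) = V_k · c^{n_k}`. Then
`Q'((1+T)^p − 1) · Q^p = Q'^p · Q((1+T)^p − 1)` in `𝓞_{ℂ_p}⟦T⟧` (both sides take the value
`V_{k+1} c^{n_{k+1}} V_k^p` at `x_k`; identity principle `R1.intSeries_eq_of_hasValueAt`). The ♭ twin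
(`θ = 1`) of cn100's `CongruentShaFreeCutBDPUpToPowerMapIdentity.powerMap_identity_of_values`.
[cite: Washington1997, §7.2 (the p-power map)] [cite: Cassels1986, Ch. 4 Thm. 4.1 (identity principle)] -/
theorem flat_powerMap_identity_of_values {Q Q' : PowerSeries 𝓞_ℂ_[p]} {c : ℂ_[p]} {x V : ℕ → ℂ_[p]}
    {n : ℕ → ℕ} (hx1 : ∀ k, ‖x k‖ < 1) (hx0 : ∀ k, x k ≠ 0) (hx : Tendsto x atTop (𝓝 0))
    (hstep : ∀ k, x (k + 1) = (1 + x k) ^ p - 1) (hn : ∀ k, n (k + 1) = p * n k)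
    (hV : ∀ k, IntSeries.HasValueAt Q (x k) (V k))
    (hV' : ∀ k, IntSeries.HasValueAt Q' (x k) (V k * c ^ n k)) :
    Q'.subst (((1 + X : PowerSeries 𝓞_ℂ_[p]) ^ p) - 1) * Q ^ p =
      Q' ^ p * Q.subst (((1 + X : PowerSeries 𝓞_ℂ_[p]) ^ p) - 1) := by
  refine R1.intSeries_eq_of_hasValueAt (v := fun k ↦ V (k + 1) * c ^ n (k + 1) * V k ^ p) hx
    (Frequently.of_forall hx0) (fun k ↦ ?_) (fun k ↦ ?_)
  · have ha : IntSeries.HasValueAt (Q'.subst (((1 + X : PowerSeries 𝓞_ℂ_[p]) ^ p) - 1)) (x k)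
        (V (k + 1) * c ^ n (k + 1)) := by
      apply intSeries_hasValueAt_subst_powMap p (hx1 k)
      rw [← hstep k]
      exact hV' (k + 1)
    exact intSeries_hasValueAt_mul (hx1 k) ha (intSeries_hasValueAt_pow (hx1 k) (hV k) p)
  · have hb : IntSeries.HasValueAt (Q.subst (((1 + X : PowerSeries 𝓞_ℂ_[p]) ^ p) - 1)) (x k)
        (V (k + 1)) := by
      apply intSeries_hasValueAt_subst_powMap p (hx1 k)
      rw [← hstep k]
      exact hV (k + 1)
    have h := intSeries_hasValueAt_mul (hx1 k) (intSeries_hasValueAt_pow (hx1 k) (hV' k) p) hb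
    convert h using 1
    rw [hn k, pow_mul]
    ring

section Frame

variable {K : Type} [Field K] [NumberField K] {N : ℕ} {ι : PadicAlgCl p ≃+* ℂ}
  {𝔭 : HeightOneSpectrum (𝓞 K)} {κ : ZpExtension K p} {γ : Field.absoluteGaloisGroup K}
  {f : CuspForm (CongruenceSubgroup.Gamma0 N) 2} {ΩK ΩK' : ℂ} {Ωp Ωp' : ℂ_[p]}
  {Q Q' : PowerSeries 𝓞_ℂ_[p]}

/-- **The power-map functional equation of two ♭-frames** (any prime `p`). If
`R1.IsBDPLFunctionInt p ι 𝔭 κ γ f Ω_K Ω_p Q` and `R1.IsBDPLFunctionInt p ι 𝔭 κ γ f Ω'_K Ω'_p Q'` for the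
SAME `(ι, 𝔭, κ, γ, f)` (`K` imaginary quadratic, `κ` anticyclotomic, `γ` a topological generator,
`Ω_K, Ω'_K, Ω_p ≠ 0`), then `Q'((1+T)^p − 1) · Q^p = Q'^p · Q((1+T)^p − 1)` in `𝓞_{ℂ_p}⟦T⟧`
(`flat_powerMap_identity_of_values` along cn100's character supply, shifted into the open disc; values
from `hQ` and `X11b.intSeries_hasValueAt_frame_rescale`).
[cite: Castella2018, Thm. 3.1 (arXiv:1704.06608 p. 9)] [cite: Washington1997, §7.2 (the p-power map)] -/
theorem flat_powerMap_identity_of_isBDPLFunctionInt (hK : IsImaginaryQuadratic K)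
    (hκ : κ.IsAnticyclotomic) (hγ : κ.IsTopGenerator γ) (hΩK : ΩK ≠ 0) (hΩK' : ΩK' ≠ 0) (hΩp : Ωp ≠ 0)
    (hQ : R1.IsBDPLFunctionInt p ι 𝔭 κ γ f ΩK Ωp Q) (hQ' : R1.IsBDPLFunctionInt p ι 𝔭 κ γ f ΩK' Ωp' Q') :
    Q'.subst (((1 + X : PowerSeries 𝓞_ℂ_[p]) ^ p) - 1) * Q ^ p =
      Q' ^ p * Q.subst (((1 + X : PowerSeries 𝓞_ℂ_[p]) ^ p) - 1) := by
  obtain ⟨m, x₀, φ, φ', r, r', hm, hx1, hx, hunr, hinf, hr, hrκ, hval, -, -, -, -, -⟩ :=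
    characterSupplyAt (p := p) K ι κ γ hK hκ hγ
  have hT0 : Tendsto (fun k ↦ x₀ ^ p ^ k - 1) atTop (𝓝 0) := by
    have := hx.sub_const 1
    simpa using this
  obtain ⟨K₀, hK₀⟩ : ∃ K₀, ∀ k ≥ K₀, ‖x₀ ^ p ^ k - 1‖ < 1 := by
    have hev : ∀ᶠ k in atTop, ‖x₀ ^ p ^ k - 1‖ < 1 := by
      have h := hT0.norm
      rw [norm_zero] at h
      exact h.eventually (gt_mem_nhds zero_lt_one)
    exact eventually_atTop.mp hev
  have hnpos : ∀ k, 0 < m * p ^ (k + K₀) := fun k ↦ Nat.mul_pos hm (pow_pos hp.out.pos _)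
  refine flat_powerMap_identity_of_values (x := fun k ↦ x₀ ^ p ^ (k + K₀) - 1)
    (V := fun k ↦ ((ι.symm (bdpInterpolationValue p f 𝔭 (φ (k + K₀)) (m * p ^ (k + K₀)) ΩK) :
      PadicAlgCl p) : ℂ_[p]) * Ωp ^ (4 * (m * p ^ (k + K₀))))
    (n := fun k ↦ m * p ^ (k + K₀))
    (c := ((ι.symm ((ΩK / ΩK') ^ 4) : PadicAlgCl p) : ℂ_[p]) * (Ωp' / Ωp) ^ 4)
    (fun k ↦ hK₀ _ (Nat.le_add_left K₀ k)) (fun k ↦ sub_ne_zero.mpr (hx1 _))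
    (hT0.comp (tendsto_add_atTop_nat K₀)) (fun k ↦ ?_) (fun k ↦ ?_) (fun k ↦ ?_) (fun k ↦ ?_)
  · show x₀ ^ p ^ (k + 1 + K₀) - 1 = (1 + (x₀ ^ p ^ (k + K₀) - 1)) ^ p - 1
    have e : k + 1 + K₀ = k + K₀ + 1 := by omega
    rw [e, add_sub_cancel, ← pow_mul, ← pow_succ]
  · show m * p ^ (k + 1 + K₀) = p * (m * p ^ (k + K₀))
    have e : k + 1 + K₀ = k + K₀ + 1 := by omega
    rw [e, pow_succ]
    ring
  · have h := hQ (φ (k + K₀)) _ (hnpos k) (hunr _) (hinf _) (r (k + K₀)) (hr _) (hrκ _)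
    rw [hval] at h
    exact h
  · have h := intSeries_hasValueAt_frame_rescale hΩK hΩK' hΩp hQ' (hnpos k) (hunr (k + K₀)) (hinf _)
      (hr _) (hrκ _)
    rw [hval] at h
    exact h

end Frame

/-! ### §2 Algebra: the functional equation with `μ(Q) = 0` forces `μ(L) = 0` -/

/-- An element of `𝓞_{ℂ_p}` of norm `1` has non-zero residue (Dwork file: `residue_eq_zero_iff'`).
[folklore] -/
theorem residue_ne_zero_of_norm_eq_one {a : 𝓞_ℂ_[p]} (ha : ‖(a : ℂ_[p])‖ = 1) :
    IsLocalRing.residue 𝓞_ℂ_[p] a ≠ 0 := by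
  rw [Ne, Literature.NumberTheory.LFunctions.Dwork.residue_eq_zero_iff', ha]
  exact lt_irrefl 1

/-- `p` has residue `0` in the residue field of `𝓞_{ℂ_p}` (characteristic `p`,
`Dwork.charP_residueField`). [folklore] -/
theorem residue_natCast_p_eq_zero :
    IsLocalRing.residue 𝓞_ℂ_[p] (p : 𝓞_ℂ_[p]) = 0 := by
  haveI := Literature.NumberTheory.LFunctions.Dwork.charP_residueField (p := p)
  rw [map_natCast]
  exact CharP.cast_eq_zero _ p

/-- Modulo the maximal ideal of `𝓞_{ℂ_p}` the `p`-power map `(1+T)^p − 1` is `T^p`. [folklore] -/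
theorem map_residue_powMap :
    PowerSeries.map (IsLocalRing.residue 𝓞_ℂ_[p]) ((((1 + X : PowerSeries 𝓞_ℂ_[p]) ^ p) - 1)) =
      (X : PowerSeries (IsLocalRing.ResidueField 𝓞_ℂ_[p])) ^ p := by
  haveI := Literature.NumberTheory.LFunctions.Dwork.charP_residueField (p := p)
  rw [map_sub, map_pow, map_add, map_one, PowerSeries.map_X, add_pow_char, one_pow,
    add_sub_cancel_left]

/-- Substituting `T^p` is injective on `k⟦T⟧` (coefficients are just spread out:
`[T^{pd}](A(T^p)) = [T^d]A`, `PowerSeries.coeff_subst_X_pow`). [folklore] -/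
theorem eq_zero_of_subst_X_pow_eq_zero {k : Type*} [CommRing k] {A : PowerSeries k}
    (h : A.subst ((X : PowerSeries k) ^ p) = 0) : A = 0 := by
  ext d
  have hd := congrArg (PowerSeries.coeff (p * d)) h
  rw [coeff_subst_X_pow hp.out.ne_zero, if_pos (dvd_mul_right p d), Nat.mul_div_cancel_left d hp.out.pos,
    map_zero, Algebra.algebraMap_self, RingHom.id_apply] at hd
  rw [hd, map_zero]

/-- **The algebraic core.** Let `Q, M ∈ 𝓞_{ℂ_p}⟦T⟧` with `Q` AND `M` each having a coefficient of norm `1`,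
and suppose `M((1+T)^p−1) · Q^p = p^j · (M^p · Q((1+T)^p−1))` with `j ≥ 1`. Contradiction: modulo the maximal
ideal the right side vanishes while the left is `M̄(T^p)·Q̄^p ≠ 0` in the domain `k̄⟦T⟧`. [folklore] -/
theorem false_of_powMap_identity_of_pow {Q M : PowerSeries 𝓞_ℂ_[p]}
    (hQ : ∃ i : ℕ, ‖((PowerSeries.coeff i Q : 𝓞_ℂ_[p]) : ℂ_[p])‖ = 1)
    (hM : ∃ i : ℕ, ‖((PowerSeries.coeff i M : 𝓞_ℂ_[p]) : ℂ_[p])‖ = 1) {j : ℕ} (hj : 1 ≤ j)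
    (h : M.subst (((1 + X : PowerSeries 𝓞_ℂ_[p]) ^ p) - 1) * Q ^ p =
      PowerSeries.C ((p : 𝓞_ℂ_[p]) ^ j) * (M ^ p * Q.subst (((1 + X : PowerSeries 𝓞_ℂ_[p]) ^ p) - 1))) :
    False := by
  set ρ := IsLocalRing.residue 𝓞_ℂ_[p] with hρ
  -- reduce the identity modulo the maximal ideal
  have hred := congrArg (PowerSeries.map ρ) h
  have hpj : ρ ((p : 𝓞_ℂ_[p]) ^ j) = 0 := by
    rw [map_pow, residue_natCast_p_eq_zero, zero_pow (by omega)]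
  have hms : PowerSeries.map ρ (M.subst (((1 + X : PowerSeries 𝓞_ℂ_[p]) ^ p) - 1)) =
      (PowerSeries.map ρ M).subst (PowerSeries.map ρ (((1 + X : PowerSeries 𝓞_ℂ_[p]) ^ p) - 1)) :=
    PowerSeries.map_subst (hasSubst_powMap p) M
  rw [map_mul, map_mul, map_pow, PowerSeries.map_C, hpj, map_zero, zero_mul, hms,
    map_residue_powMap] at hred
  -- the domain `k̄⟦T⟧`
  rcases mul_eq_zero.mp hred with h1 | h2
  · -- `M̄(T^p) = 0` forces `M̄ = 0`, contradicting the unit coefficient of `M`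
    have hM0 := eq_zero_of_subst_X_pow_eq_zero (p := p) h1
    obtain ⟨i, hi⟩ := hM
    have := congrArg (PowerSeries.coeff i) hM0
    rw [PowerSeries.coeff_map, map_zero] at this
    exact residue_ne_zero_of_norm_eq_one hi this
  · -- `Q̄^p = 0` forces `Q̄ = 0`, contradicting the unit coefficient of `Q`
    have hQ0 : PowerSeries.map ρ Q = 0 := pow_eq_zero_iff (hp.out.ne_zero) |>.mp h2
    obtain ⟨i, hi⟩ := hQ
    have := congrArg (PowerSeries.coeff i) hQ0
    rw [PowerSeries.coeff_map, map_zero] at this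
    exact residue_ne_zero_of_norm_eq_one hi this

/-- **`μ`-TRANSFER THROUGH THE FUNCTIONAL EQUATION.** Let `Q ∈ 𝓞_{ℂ_p}⟦T⟧` have a coefficient of norm `1`,
let `L ∈ R₀⟦T⟧` be non-zero, and suppose `L♭((1+T)^p−1)·Q^p = L♭^p·Q((1+T)^p−1)` for `L♭ = L` read in
`𝓞_{ℂ_p}⟦T⟧`. Then `L` has a coefficient of norm `1`. Proof: `L = p^μ L₀` with `L₀ ≢ 0 (mod p)` (cn100
`UnrSeries.exists_eq_C_pow_mul_map_residue_ne_zero`); if `μ ≥ 1`, cancel `p^μ` (domain) and apply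
`false_of_powMap_identity_of_pow` with `j = (p−1)μ`. [cite: Washington1997, §7.1–7.2] -/
theorem exists_coeff_norm_eq_one_of_flat_powerMap_identity {Q : PowerSeries 𝓞_ℂ_[p]} {L : UnrSeries p}
    (hQ : ∃ i : ℕ, ‖((PowerSeries.coeff i Q : 𝓞_ℂ_[p]) : ℂ_[p])‖ = 1) (hL : L ≠ 0)
    (h : (PowerSeries.map (R1.unrToCpInt p) L).subst (((1 + X : PowerSeries 𝓞_ℂ_[p]) ^ p) - 1) * Q ^ p =
      PowerSeries.map (R1.unrToCpInt p) L ^ p * Q.subst (((1 + X : PowerSeries 𝓞_ℂ_[p]) ^ p) - 1)) :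
    ∃ i : ℕ, ‖((PowerSeries.coeff i L : unrIntegers p) : ℂ_[p])‖ = 1 := by
  haveI := isDiscreteValuationRing_unrIntegers (p := p)
  obtain ⟨μ, L₀, hLμ, hL₀⟩ := UnrSeries.exists_eq_C_pow_mul_map_residue_ne_zero hL
  -- `L₀` has a coefficient that is a unit of `R₀`, i.e. of norm `1`
  have hL₀unit : ∃ i : ℕ, ‖((PowerSeries.coeff i L₀ : unrIntegers p) : ℂ_[p])‖ = 1 := by
    by_contra hcon
    push Not at hcon
    apply hL₀
    ext i
    rw [PowerSeries.coeff_map, map_zero, IsLocalRing.residue_eq_zero_iff, IsLocalRing.mem_maximalIdeal,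
      mem_nonunits_iff, unrIntegers.isUnit_iff_norm_eq_one]
    exact hcon i
  set M : PowerSeries 𝓞_ℂ_[p] := PowerSeries.map (R1.unrToCpInt p) L₀ with hMdef
  have hM : ∃ i : ℕ, ‖((PowerSeries.coeff i M : 𝓞_ℂ_[p]) : ℂ_[p])‖ = 1 := by
    obtain ⟨i, hi⟩ := hL₀unit
    exact ⟨i, by rw [hMdef, PowerSeries.coeff_map, R1.coe_unrToCpInt, hi]⟩
  rcases Nat.eq_zero_or_pos μ with hμ | hμ
  · -- `μ = 0`: `L = L₀`
    rw [hμ, pow_zero, PowerSeries.C.map_one, one_mul] at hLμ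
    rw [hLμ]; exact hL₀unit
  · exfalso
    -- `L♭ = p^μ · M`
    have hpmap : (R1.unrToCpInt p) (((p : ℕ) : unrIntegers p) ^ μ) = (p : 𝓞_ℂ_[p]) ^ μ := by
      rw [map_pow, map_natCast]
    have hLflat : PowerSeries.map (R1.unrToCpInt p) L = PowerSeries.C ((p : 𝓞_ℂ_[p]) ^ μ) * M := by
      rw [hLμ, map_mul, PowerSeries.map_C, hpmap]
    -- substitute into the functional equation
    have hsubstC : (PowerSeries.C ((p : 𝓞_ℂ_[p]) ^ μ) * M).subst (((1 + X : PowerSeries 𝓞_ℂ_[p]) ^ p) - 1) =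
        PowerSeries.C ((p : 𝓞_ℂ_[p]) ^ μ) * M.subst (((1 + X : PowerSeries 𝓞_ℂ_[p]) ^ p) - 1) := by
      rw [← smul_eq_C_mul, ← smul_eq_C_mul, PowerSeries.subst_smul (hasSubst_powMap p)]
    rw [hLflat] at h
    -- `h : (C(p^μ)·M)(Φ) * Q^p = (C(p^μ)·M)^p * Q(Φ)`; normalise both sides and cancel `C(p^μ)`
    have hp0 : (PowerSeries.C ((p : 𝓞_ℂ_[p]) ^ μ) : PowerSeries 𝓞_ℂ_[p]) ≠ 0 := by
      intro h0
      have := congrArg PowerSeries.constantCoeff h0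
      rw [PowerSeries.constantCoeff_C, map_zero] at this
      exact pow_ne_zero μ (by exact_mod_cast hp.out.ne_zero : (p : 𝓞_ℂ_[p]) ≠ 0) this
    have hsplit : (p : 𝓞_ℂ_[p]) ^ (μ * p) = (p : 𝓞_ℂ_[p]) ^ μ * (p : 𝓞_ℂ_[p]) ^ ((p - 1) * μ) := by
      rw [← pow_add]
      congr 1
      have h1 : 1 ≤ p := hp.out.one_le
      zify [h1]
      ring
    have hpow : (PowerSeries.C ((p : 𝓞_ℂ_[p]) ^ μ) * M) ^ p =
        PowerSeries.C ((p : 𝓞_ℂ_[p]) ^ μ) * (PowerSeries.C ((p : 𝓞_ℂ_[p]) ^ ((p - 1) * μ)) * M ^ p) := by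
      rw [mul_pow, ← map_pow, ← pow_mul, hsplit, map_mul, mul_assoc]
    have key : PowerSeries.C ((p : 𝓞_ℂ_[p]) ^ μ) *
          (M.subst (((1 + X : PowerSeries 𝓞_ℂ_[p]) ^ p) - 1) * Q ^ p) =
        PowerSeries.C ((p : 𝓞_ℂ_[p]) ^ μ) * (PowerSeries.C ((p : 𝓞_ℂ_[p]) ^ ((p - 1) * μ)) *
          (M ^ p * Q.subst (((1 + X : PowerSeries 𝓞_ℂ_[p]) ^ p) - 1))) := by
      calc PowerSeries.C ((p : 𝓞_ℂ_[p]) ^ μ) * (M.subst (((1 + X : PowerSeries 𝓞_ℂ_[p]) ^ p) - 1) * Q ^ p)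
          = (PowerSeries.C ((p : 𝓞_ℂ_[p]) ^ μ) * M).subst (((1 + X : PowerSeries 𝓞_ℂ_[p]) ^ p) - 1) *
              Q ^ p := by rw [hsubstC, mul_assoc]
        _ = (PowerSeries.C ((p : 𝓞_ℂ_[p]) ^ μ) * M) ^ p *
              Q.subst (((1 + X : PowerSeries 𝓞_ℂ_[p]) ^ p) - 1) := h
        _ = PowerSeries.C ((p : 𝓞_ℂ_[p]) ^ μ) * (PowerSeries.C ((p : 𝓞_ℂ_[p]) ^ ((p - 1) * μ)) *
              (M ^ p * Q.subst (((1 + X : PowerSeries 𝓞_ℂ_[p]) ^ p) - 1))) := by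
            rw [hpow, mul_assoc, mul_assoc]
    have h' := mul_left_cancel₀ hp0 key
    exact false_of_powMap_identity_of_pow hQ hM (Nat.mul_pos (Nat.sub_pos_of_lt hp.out.one_lt) hμ) h'

/-! ### §3 Two ♭-frames vanish together -/

section Vanish

variable {K : Type} [Field K] [NumberField K] {N : ℕ} {ι : PadicAlgCl p ≃+* ℂ}
  {𝔭 : HeightOneSpectrum (𝓞 K)} {κ : ZpExtension K p} {γ : Field.absoluteGaloisGroup K}
  {f : CuspForm (CongruenceSubgroup.Gamma0 N) 2} {ΩK ΩK' : ℂ} {Ωp Ωp' : ℂ_[p]}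
  {Q Q' : PowerSeries 𝓞_ℂ_[p]}

/-- If the first ♭-frame's series is `0` then so is the second's: its values are `c^n` times the first
frame's values, which vanish, along the supplied characters accumulating at `𝟙`; identity principle.
The ♭ version of cn100's `eq_zero_of_isBDPLFunctionUpTo_of_eq_zero`. [cite: Castella2018, Thm. 3.1] -/
theorem intSeries_eq_zero_of_isBDPLFunctionInt_of_eq_zero (hK : IsImaginaryQuadratic K)
    (hκ : κ.IsAnticyclotomic) (hγ : κ.IsTopGenerator γ) (hΩK : ΩK ≠ 0) (hΩK' : ΩK' ≠ 0) (hΩp : Ωp ≠ 0)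
    (hQ : R1.IsBDPLFunctionInt p ι 𝔭 κ γ f ΩK Ωp Q) (hQ' : R1.IsBDPLFunctionInt p ι 𝔭 κ γ f ΩK' Ωp' Q')
    (h0 : Q = 0) : Q' = 0 := by
  obtain ⟨m, x₀, φ, φ', r, r', hm, hx1, hx, hunr, hinf, hr, hrκ, hval, -, -, -, -, -⟩ :=
    characterSupplyAt (p := p) K ι κ γ hK hκ hγ
  have hT0 : Tendsto (fun k ↦ x₀ ^ p ^ k - 1) atTop (𝓝 0) := by
    have := hx.sub_const 1
    simpa using this
  have hnpos : ∀ k, 0 < m * p ^ k := fun k ↦ Nat.mul_pos hm (pow_pos hp.out.pos _)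
  refine R1.intSeries_eq_of_hasValueAt (v := fun _ ↦ 0) hT0
    (Frequently.of_forall fun k ↦ sub_ne_zero.mpr (hx1 k)) (fun k ↦ ?_)
    (fun k ↦ intSeries_hasValueAt_zero_series _)
  -- the first frame's value at `φ_k` is `0`
  have h1 := hQ (φ k) _ (hnpos k) (hunr _) (hinf _) (r k) (hr _) (hrκ _)
  rw [hval, h0] at h1
  have hV0 := (intSeries_hasValueAt_zero_series (p := p) (x₀ ^ p ^ k - 1)).unique h1
  -- the second frame's value is `c^n` times it
  have h2 := intSeries_hasValueAt_frame_rescale hΩK hΩK' hΩp hQ' (hnpos k) (hunr k) (hinf _) (hr _) (hrκ _)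
  rw [hval, ← hV0, zero_mul] at h2
  exact h2

end Vanish

/-! ### §4 The `μ`-transfer across periods and receptacles -/

section Transfer

variable {K : Type} [Field K] [NumberField K] {N : ℕ} {ι : PadicAlgCl p ≃+* ℂ}
  {𝔭 : HeightOneSpectrum (𝓞 K)} {κ : ZpExtension K p} {γ : Field.absoluteGaloisGroup K}
  {f : CuspForm (CongruenceSubgroup.Gamma0 N) 2} {ΩK ΩK' : ℂ} {Ωp Ωp' : ℂ_[p]}
  {Q : PowerSeries 𝓞_ℂ_[p]} {L : UnrSeries p}

/-- **`μ = 0` PASSES FROM A ♭-FRAME TO EVERY `R₀`-FRAME, ACROSS PERIODS** (any prime `p`). For `K`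
imaginary quadratic, `κ` anticyclotomic with topological generator `γ`, non-zero periods
`Ω_K, Ω'_K ∈ ℂ`, `Ω_p, Ω'_p ∈ ℂ_p`: if `Q ∈ 𝓞_{ℂ_p}⟦T⟧` carries Castella's interpolation property
`R1.IsBDPLFunctionInt p ι 𝔭 κ γ f Ω_K Ω_p Q` and has a coefficient of norm `1`, then every `L ∈ R₀⟦T⟧` with
`IsBDPLFunction ι 𝔭 κ γ f Ω'_K Ω'_p L` has a coefficient of norm `1`. (§1 functional equation for the pair
`(Q, L♭)`; `L ≠ 0` by §3 since `Q ≠ 0`; §2.) This discharges, in `μ`-currency, the cross-period ♭-rigidity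
that `UniversalToricDescentTwinMuZero.stub_twinMuZero_of_thmB_of_flatRigidity` asks for.
[cite: Castella2018, Thm. 3.1 (arXiv:1704.06608 p. 9)] [cite: Washington1997, §7.1–7.2] -/
theorem exists_coeff_norm_eq_one_of_isBDPLFunctionInt_of_isBDPLFunction (hK : IsImaginaryQuadratic K)
    (hκ : κ.IsAnticyclotomic) (hγ : κ.IsTopGenerator γ) (hΩK : ΩK ≠ 0) (hΩK' : ΩK' ≠ 0) (hΩp : Ωp ≠ 0)
    (hΩp' : Ωp' ≠ 0) (hQ : R1.IsBDPLFunctionInt p ι 𝔭 κ γ f ΩK Ωp Q)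
    (hL : IsBDPLFunction ι 𝔭 κ γ f ΩK' Ωp' L)
    (hμ : ∃ i : ℕ, ‖((PowerSeries.coeff i Q : 𝓞_ℂ_[p]) : ℂ_[p])‖ = 1) :
    ∃ i : ℕ, ‖((PowerSeries.coeff i L : unrIntegers p) : ℂ_[p])‖ = 1 := by
  have hLflat : R1.IsBDPLFunctionInt p ι 𝔭 κ γ f ΩK' Ωp' (PowerSeries.map (R1.unrToCpInt p) L) :=
    R1.isBDPLFunctionInt_map hL
  -- `Q ≠ 0`, hence `L♭ ≠ 0`, hence `L ≠ 0`
  have hQ0 : Q ≠ 0 := by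
    rintro rfl
    obtain ⟨i, hi⟩ := hμ
    simp at hi
  have hL0 : L ≠ 0 := by
    intro h
    apply hQ0
    refine intSeries_eq_zero_of_isBDPLFunctionInt_of_eq_zero hK hκ hγ hΩK' hΩK hΩp' hLflat hQ ?_
    rw [h, map_zero]
  exact exists_coeff_norm_eq_one_of_flat_powerMap_identity hμ hL0
    (flat_powerMap_identity_of_isBDPLFunctionInt hK hκ hγ hΩK hΩK' hΩp hQ hLflat)

end Transfer

end Summit.BirchSwinnertonDyer.BirchSwinnertonDyer.Theorems.UniversalToricDescentFlatMuTransfer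

end
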